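import Mathlib
import Summits.AtomisticToContinuum.FouriersLaw.Theses.EmbeddedDrudeMourre
import Summits.AtomisticToContinuum.FouriersLaw.Theorems.EmbeddedDrudeMourreDrudeDissolutionStubExcursionSecondDifferencePlaneSheetTransversal
import Summits.AtomisticToContinuum.FouriersLaw.Theorems.EmbeddedDrudeMourreMourreDissolutionRegularLevels
import HarnessLib

/-!
# Geometry of the free pair resonance for stub B1b″ of line `kinetic-polymer-gas-on-the-time-axis`:
# the restricted resonant sheet is a regular curve everywhere
(crux `EmbeddedDrudeMourre.DrudeDissolution`, item stmt-AtomisticToContinuum-12593; `--supports` file, closes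
nothing; lead c13, geometry input (G-I1⁺) of the B1b″ floor)

WHAT. `sheetFn_plane_regular`: for `ω₂ > 0` the restriction of the sheet function to an exchange plane,
`H₀(k₁,k₂) = 2(ω(k₁)ω(k₂)+ω₂+2)cos((k₁+k₂)/2) − 4cos((k₁−k₂)/2)`, has NO critical zero at all: `H₀(k₁,k₂) = 0 ⇒
DH₀(k₁,k₂) ≠ 0`. (`sheetFn_plane_transversal` left the triple points `cos k₁ = cos k₂ = c*` undecided; they are
decided here: at a triple point on `{H₀ = 0}` one has `k₂ ≡ k₁ (mod 2π)` and the derivative of `H₀` along `(1,1)` is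
`±4 sin k (2cos k − ω₂ − 2) ≠ 0`, `sheetFn_diag_deriv_ne_zero`.) Hence `{H₀ = 0}` — the co-moving curve through the
triple points — is a regular closed curve on the `2`-torus, which is what the tube-volume and transversality inputs of
the floor `|∇Ω|² ≥ c·m²` consume.

HOW. `sheetFn_plane_transversal` + `groupVelocity_eq_of_sheetFn_plane_eq_zero` force `cos k₁ = cos k₂`,
`sin k₁ = sin k₂` (`ω(k₁) = ω(k₂)`, `v(k₁) = v(k₂)`), so `k₂ = k₁ + 2πn` (`Real.Angle.cos_sin_inj`); along the line
`t ↦ (k₁+t, k₂+t)` the function is `(−1)ⁿ(2(ω(k₁+t)²+ω₂+2)cos(k₁+t) − 4)`, whose derivative at `0` is non-zero, while a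
vanishing Fréchet derivative would make it zero (chain rule + uniqueness of derivatives).
-/

noncomputable section

open Set Real Topology
open Literature.MathematicalPhysics.KineticTheory
open Literature.MathematicalPhysics.KineticTheory.PhononBoltzmann

namespace Summit.AtomisticToContinuum.FouriersLaw.Theorems.DrudeDissolution.KineticPolymerGasOnTheTimeAxis

/-- **Registered sub-goal `sheetFn_plane_regular` (G-I1⁺): the restricted resonant sheet has no critical zero.**
For `ω₂ > 0` and all `k₁ k₂`: if `H₀(k₁,k₂) = 2(ω(k₁)ω(k₂)+ω₂+2)cos((k₁+k₂)/2) − 4cos((k₁−k₂)/2) = 0` then the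
Fréchet derivative of `q ↦ H₀(q.1,q.2)` at `(k₁,k₂)` is non-zero. [folklore] -/
theorem sheetFn_plane_regular :
    ∀ ω₂ : ℝ, 0 < ω₂ → ∀ k₁ k₂ : ℝ,
      2 * (dispersion ω₂ k₁ * dispersion ω₂ k₂ + ω₂ + 2) * Real.cos ((k₁ + k₂) / 2) -
          4 * Real.cos ((k₁ - k₂) / 2) = 0 →
      fderiv ℝ (fun q : ℝ × ℝ => 2 * (dispersion ω₂ q.1 * dispersion ω₂ q.2 + ω₂ + 2) * Real.cos ((q.1 + q.2) / 2) -
          4 * Real.cos ((q.1 - q.2) / 2)) (k₁, k₂) ≠ 0 := by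
  intro ω₂ hω k₁ k₂ hH hD
  -- the point is a triple point on the diagonal
  obtain ⟨hc1, hc2⟩ := sheetFn_plane_transversal ω₂ hω k₁ k₂ hH hD
  have hv : groupVelocity ω₂ k₂ = groupVelocity ω₂ k₁ := groupVelocity_eq_of_sheetFn_plane_eq_zero hω hH
  have hcos : Real.cos k₁ = Real.cos k₂ := by rw [hc1, hc2]
  have hω12 : dispersion ω₂ k₁ = dispersion ω₂ k₂ := MourreDissolution.regularLevels_dispersion_eq hcos
  have hsin : Real.sin k₁ = Real.sin k₂ := by
    have h1 := dispersion_pos hω k₁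
    unfold groupVelocity at hv
    rw [hω12] at hv
    rw [div_eq_div_iff (dispersion_pos hω k₂).ne' (dispersion_pos hω k₂).ne'] at hv
    have := mul_right_cancel₀ (dispersion_pos hω k₂).ne' hv
    exact this.symm
  obtain ⟨n, hn⟩ := Real.Angle.angle_eq_iff_two_pi_dvd_sub.1 (Real.Angle.cos_sin_inj hcos.symm hsin.symm)
  -- `hn : k₂ - k₁ = 2π n`
  -- differentiability of `H₀` and the chain rule along the line `t ↦ (k₁ + t, k₂ + t)`
  set Hf : ℝ × ℝ → ℝ := fun q => 2 * (dispersion ω₂ q.1 * dispersion ω₂ q.2 + ω₂ + 2) * Real.cos ((q.1 + q.2) / 2) -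
      4 * Real.cos ((q.1 - q.2) / 2) with hHf
  have hd : Differentiable ℝ (dispersion ω₂) := fun k => (hasDerivAt_dispersion hω k).differentiableAt
  have hHd : DifferentiableAt ℝ Hf (k₁, k₂) := by
    rw [hHf]
    have c1 : Differentiable ℝ fun q : ℝ × ℝ => dispersion ω₂ q.1 := hd.comp differentiable_fst
    have c2 : Differentiable ℝ fun q : ℝ × ℝ => dispersion ω₂ q.2 := hd.comp differentiable_snd
    have c3 : Differentiable ℝ fun q : ℝ × ℝ => Real.cos ((q.1 + q.2) / 2) := by fun_prop
    have c4 : Differentiable ℝ fun q : ℝ × ℝ => 4 * Real.cos ((q.1 - q.2) / 2) := by fun_prop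
    have c5 : Differentiable ℝ fun q : ℝ × ℝ => 2 * (dispersion ω₂ q.1 * dispersion ω₂ q.2 + ω₂ + 2) := by
      have := ((c1.mul c2).add_const ω₂).add_const 2
      exact this.const_mul 2
    exact ((c5.mul c3).sub c4).differentiableAt
  have hline : HasDerivAt (fun t : ℝ => ((k₁, k₂) : ℝ × ℝ) + t • ((1, 1) : ℝ × ℝ)) ((1, 1) : ℝ × ℝ) 0 := by
    have := ((hasDerivAt_id (0 : ℝ)).smul_const ((1, 1) : ℝ × ℝ)).const_add ((k₁, k₂) : ℝ × ℝ)
    simpa using this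
  have hcomp : HasDerivAt (Hf ∘ fun t : ℝ => ((k₁, k₂) : ℝ × ℝ) + t • ((1, 1) : ℝ × ℝ))
      (fderiv ℝ Hf ((k₁, k₂) + (0 : ℝ) • ((1, 1) : ℝ × ℝ)) ((1, 1) : ℝ × ℝ)) 0 := by
    refine HasFDerivAt.comp_hasDerivAt (0 : ℝ) ?_ hline
    rw [zero_smul, add_zero]
    exact hHd.hasFDerivAt
  rw [zero_smul, add_zero, hD, zero_apply] at hcomp
  -- along the line the function is `(−1)ⁿ g`, `g t = 2(ω(k₁+t)² + ω₂ + 2)cos(k₁+t) − 4`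
  have hfun : (Hf ∘ fun t : ℝ => ((k₁, k₂) : ℝ × ℝ) + t • ((1, 1) : ℝ × ℝ)) =
      fun t : ℝ => (-1 : ℝ) ^ n * (2 * (dispersion ω₂ (k₁ + t) ^ 2 + ω₂ + 2) * Real.cos (k₁ + t) - 4) := by
    funext t
    simp only [Function.comp_apply, hHf, Prod.smul_mk, Prod.mk_add_mk, smul_eq_mul, mul_one]
    have e2 : k₂ + t = (k₁ + t) + n * (2 * Real.pi) := by linarith
    have hper := dispersion_periodic ω₂
    rw [e2, hper.int_mul n (k₁ + t)]
    have ea : (k₁ + t + (k₁ + t + n * (2 * Real.pi))) / 2 = (k₁ + t) + n * Real.pi := by ring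
    have eb : (k₁ + t - (k₁ + t + n * (2 * Real.pi))) / 2 = -(0 + n * Real.pi) := by ring
    rw [ea, eb, Real.cos_neg, Real.cos_add_int_mul_pi, Real.cos_add_int_mul_pi, Real.cos_zero, mul_one]
    ring
  rw [hfun] at hcomp
  -- compare with the true derivative
  obtain ⟨-, hg, hne⟩ := sheetFn_diag_deriv_ne_zero ω₂ hω k₁ hc1
  have hg' := hg.const_mul ((-1 : ℝ) ^ n)
  have huniq := hcomp.unique hg'
  have hpow : ((-1 : ℝ) ^ n) ≠ 0 := zpow_ne_zero _ (by norm_num)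
  exact hne ((mul_eq_zero.1 huniq.symm).resolve_left hpow)

end Summit.AtomisticToContinuum.FouriersLaw.Theorems.DrudeDissolution.KineticPolymerGasOnTheTimeAxis

end
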